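import Summits.AtomisticToContinuum.Crystallization.Theorems.ChargedEnergyGapSphereRows
import HarnessLib

/-!
# §113I «MirrorUnit» — a sphere unit checked on a fundamental domain of the axis swap `1 ↔ 2` (lens-3 g95, line 14231 ChargedEnergyGap /
PricedLinkCensus r3, deciding leaf (T¹ᶜ) `StencilChartLawQ 130 (1/60000000) 160 (3/100) (679/1000) (691/1000)`)

Imports NODE 113F «SphereRows» (tree: `sphRows`, `StationCert.sound_dietSph`, `SphUnit`, `SphUnit.check/sound`) and, through it, NODE 111
«AxisWLOG» (tree: the relabelled tuple `tupleRelabel g σ dt` and its invariances `pos_tupleRelabel`, `isChartRealisable_tupleRelabel`,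
`feetHoleCost_tupleRelabel`, `chargeDepth_tupleRelabel`, `poleSum_tupleRelabel`, `tupleRelabel_vertex`, `tupleRelabel_zero`).

THE SYMMETRY.  The axis-`0` chamber `poleSum dt 0 ≤ poleSum dt 1, poleSum dt 0 ≤ poleSum dt 2` with the pole order `dt (a,T) ≤ dt (a,F)` (the
domain of every sphere unit, 113F) is stable under the relabelling `g = 1, σ = 0` (axes `1 ↔ 2`, no pole flip), and so are chart realisability,
positivity, both sides of (T¹ᶜ) (NODE 111) and — when the H-description's vertex box is `1 ↔ 2`-symmetric (`StationRowsCert.symm12`, six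
equalities of rationals) — the box.  The centre's unit direction is twisted by the same swap, so a tuple whose direction lies in the MIRROR CELL
`cell.swap12` relabels to one whose direction lies in `cell`: ★★ `StationCert.sound_dietSph_swap12` — ONE station certificate checked with the
nine rows of `cell` proves (T¹ᶜ) on `cell` (113F) AND on `cell.swap12` (this file; needs `0 < ρ0` for the invariance of `chargeDepth`).

THE MIRROR UNIT.  Same data as a sphere unit (`SphUnit`, 113F); the MIRROR CHECKER `SphUnit.checkM` certifies the cover against the DOUBLED cell
list `cellsM = cells ++ cells.map swap12` (a `cell j` leaf of the cover with `j ≥ parts.length` names the mirror of part `j − parts.length`),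
checks `0 < ρ0`, the box symmetry and every part's station with its own cell's rows; ★★★ `SphUnit.soundM` has the binders and the conclusion of
113F `SphUnit.sound` exactly.  A unit over a `1 ↔ 2`-symmetric box thus carries certificates for a set of REPRESENTATIVE cells only (one per
mirror pair + the self-mirror cells): the band-1 door cover of 22 cells needs 13 parts (measured g95: bytes ÷1.71, kernel time ÷1.85).
[EQUIV (a symmetry of the statement; no estimate moved, no constant changed) · COUNT-CRITICAL · (T¹ᶜ) itself UNDECIDED(test = (D¹)).]
-/

namespace Summit.AtomisticToContinuum.Crystallization.Theorems.ChargedEnergyGapChartDial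

open scoped Classical
open Literature.MathematicalPhysics.StatisticalMechanics Literature.Geometry.DiscreteGeometry
open Summit.AtomisticToContinuum.Crystallization.Theses.PricedLinkCensus
open Summit.AtomisticToContinuum.Crystallization.Theorems.ChargedEnergyGapNegative

/-! ## §113I.1 The axis swap `1 ↔ 2` on cells, boxes and tuples -/
section Swap

/-- The MIRROR CELL: coordinates of axes `1` and `2` exchanged. -/
def Box3.swap12 (c : Box3) : Box3 := ⟨c.l0, c.l2, c.l1, c.h0, c.h2, c.h1⟩

/-- [finite check] the axis permutation `axp 1` is the transposition `1 ↔ 2`. -/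
theorem axp_one : axp 1 0 = 0 ∧ axp 1 1 = 2 ∧ axp 1 2 = 1 := by decide

/-- [finite check] the relabelling `(1, 0)` swaps the axes `1 ↔ 2` and keeps the pole. -/
theorem relabel_one_zero (a : Fin 3) (b : Bool) : relabel 1 0 (a, b) = (axp 1 a, b) := by
  revert a b; decide

/-- [formal bookkeeping] lower corner of the mirror cell. -/
theorem Box3.swap12_lo (c : Box3) (a : Fin 3) : c.swap12.lo (axp 1 a) = c.lo a := by
  fin_cases a <;> rfl

/-- [formal bookkeeping] upper corner of the mirror cell. -/
theorem Box3.swap12_hi (c : Box3) (a : Fin 3) : c.swap12.hi (axp 1 a) = c.hi a := by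
  fin_cases a <;> rfl

/-- ★ The vertex box of an H-description is SYMMETRIC under the axis swap `1 ↔ 2` (six equalities of rationals, kernel-decidable). -/
def StationRowsCert.symm12 (R : StationRowsCert) : Bool :=
  decide (∀ q : Fin 3 × Bool, R.lo (relabel 1 0 q) = R.lo q ∧ R.hi (relabel 1 0 q) = R.hi q)

/-- [formal bookkeeping] reading the symmetry check. -/
theorem StationRowsCert.symm12_spec {R : StationRowsCert} (h : R.symm12 = true) (q : Fin 3 × Bool) :
    R.lo (relabel 1 0 q) = R.lo q ∧ R.hi (relabel 1 0 q) = R.hi q :=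
  (of_decide_eq_true h) q

/-- ★★ **MIRROR SOUNDNESS OF A CELL STATION**: a station certificate checked (113D `checkDX`) with the nine rows of `cell`, over a
`1 ↔ 2`-symmetric vertex box and with `0 < ρ0`, proves (T¹ᶜ) for the FNF chamber tuples of its box whose direction lies in the MIRROR cell
`cell.swap12` — by 113F `sound_dietSph` applied to the relabelled tuple `tupleRelabel 1 0 dt` (NODE 111 invariances; the chamber and the pole
order are stable under the swap, the box by `symm12`, the cell rows trade places). -/
theorem StationCert.sound_dietSph_swap12 (c : StationCert) (X : DietCert) (cell : Box3)
    (h : c.checkDX X (sphRows cell c.R.rho0 c.R.rho1) = true) (hs : c.R.symm12 = true) (hρ0 : 0 < c.R.rho0) :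
    ∀ ρ : ℝ, (c.R.rho0 : ℝ) ≤ ρ → ρ ≤ c.R.rho1 → ∀ dt : (Fin 3 → ℤ) → ℝ,
      (∀ q, castW c.R.lo q ≤ dt (holeVertex 0 q) ∧ dt (holeVertex 0 q) ≤ castW c.R.hi q) → ((c.R.loC : ℝ) ≤ dt 0 ∧ dt 0 ≤ c.R.hiC) →
      IsChartRealisable ρ dt → (∀ p ∈ stencil 0, 0 < dt p) → poleSum dt 0 ≤ poleSum dt 1 → poleSum dt 0 ≤ poleSum dt 2 →
      (∀ a : Fin 3, dt (holeVertex 0 (a, true)) ≤ dt (holeVertex 0 (a, false))) →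
      (∀ a : Fin 3, dt (holeVertex 0 (a, true)) ^ 2 - dt 0 ^ 2 + 2 * (cell.swap12.lo a : ℝ) * c.R.rho0 * dt 0 ≤ (c.R.rho1 : ℝ) ^ 2) →
      (∀ (a : Fin 3) (b : Bool), dt (holeVertex 0 (a, b)) ^ 2 - dt 0 ^ 2 - 2 * (cell.swap12.hi a : ℝ) * c.R.rho1 * dt 0 ≤ (c.R.rho1 : ℝ) ^ 2) →
      feetHoleCost 160 (3 / 100) ρ dt 0 ≤ domCapK c.u 160 (3 / 100) ρ (chargeDepth ρ dt 0) := by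
  intro ρ h₀ h₁ dt hbox hC hreal hpos hch1 hch2 hchp hlo hhi
  have hρ : (0 : ℝ) < ρ := lt_of_lt_of_le (by exact_mod_cast hρ0) h₀
  have hv : ∀ (a : Fin 3) (b : Bool), tupleRelabel 1 0 dt (holeVertex 0 (a, b)) = dt (holeVertex 0 (axp 1 a, b)) := fun a b => by
    rw [tupleRelabel_vertex, relabel_one_zero]
  have h0 : tupleRelabel 1 0 dt 0 = dt 0 := tupleRelabel_zero 1 0 dt
  have hp0 : poleSum (tupleRelabel 1 0 dt) 0 = poleSum dt 0 := by rw [poleSum_tupleRelabel, axp_one.1]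
  have hp1 : poleSum (tupleRelabel 1 0 dt) 1 = poleSum dt 2 := by rw [poleSum_tupleRelabel, axp_one.2.1]
  have hp2 : poleSum (tupleRelabel 1 0 dt) 2 = poleSum dt 1 := by rw [poleSum_tupleRelabel, axp_one.2.2]
  have hbox' : ∀ q, castW c.R.lo q ≤ tupleRelabel 1 0 dt (holeVertex 0 q) ∧ tupleRelabel 1 0 dt (holeVertex 0 q) ≤ castW c.R.hi q := by
    intro q
    have hb := hbox (relabel 1 0 q)
    rw [castW_apply, castW_apply, (c.R.symm12_spec hs q).1, (c.R.symm12_spec hs q).2] at hb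
    rw [tupleRelabel_vertex, castW_apply, castW_apply]
    exact hb
  have hC' : (c.R.loC : ℝ) ≤ tupleRelabel 1 0 dt 0 ∧ tupleRelabel 1 0 dt 0 ≤ c.R.hiC := by rw [h0]; exact hC
  have hchp' : ∀ a : Fin 3, tupleRelabel 1 0 dt (holeVertex 0 (a, true)) ≤ tupleRelabel 1 0 dt (holeVertex 0 (a, false)) := fun a => by
    rw [hv, hv]; exact hchp (axp 1 a)
  have hlo' : ∀ a : Fin 3, tupleRelabel 1 0 dt (holeVertex 0 (a, true)) ^ 2 - tupleRelabel 1 0 dt 0 ^ 2 +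
      2 * (cell.lo a : ℝ) * c.R.rho0 * tupleRelabel 1 0 dt 0 ≤ (c.R.rho1 : ℝ) ^ 2 := fun a => by
    rw [hv, h0, ← Box3.swap12_lo cell a]; exact hlo (axp 1 a)
  have hhi' : ∀ (a : Fin 3) (b : Bool), tupleRelabel 1 0 dt (holeVertex 0 (a, b)) ^ 2 - tupleRelabel 1 0 dt 0 ^ 2 -
      2 * (cell.hi a : ℝ) * c.R.rho1 * tupleRelabel 1 0 dt 0 ≤ (c.R.rho1 : ℝ) ^ 2 := fun a b => by
    rw [hv, h0, ← Box3.swap12_hi cell a]; exact hhi (axp 1 a) b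
  have hlaw := c.sound_dietSph X cell h ρ h₀ h₁ (tupleRelabel 1 0 dt) hbox' hC' (isChartRealisable_tupleRelabel 1 0 hreal)
    (pos_tupleRelabel 1 0 hpos) (by rw [hp0, hp1]; exact hch2) (by rw [hp0, hp2]; exact hch1) hchp' hlo' hhi'
  rwa [feetHoleCost_tupleRelabel, chargeDepth_tupleRelabel 1 0 hρ.ne'] at hlaw

end Swap

/-! ## §113I.2 The mirror unit: representative cells certified, mirror cells covered -/
section Unit

/-- The DOUBLED cell list of a unit: the parts' cells, then their mirrors (a cover leaf `cell j` with `j ≥ parts.length` names the mirror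
of part `j − parts.length`). -/
def SphUnit.cellsM (U : SphUnit) : List Box3 := U.cells ++ U.cells.map Box3.swap12

/-- ★ THE MIRROR CHECKER: the cover checks against the doubled cell list, the doubled cells have nonnegative lower corners, `0 < ρ0`, the
vertex box is `1 ↔ 2`-symmetric, and every part's station checks (113D `checkDX`) with the nine rows of its own cell. -/
def SphUnit.checkM (U : SphUnit) : Bool :=
  U.cover.check U.cellsM unitCube && U.cellsM.all (fun c => decide (0 ≤ c.l0 ∧ 0 ≤ c.l1 ∧ 0 ≤ c.l2)) && decide (0 < U.R.rho0) && U.R.symm12 &&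
    U.parts.all (fun P => (U.station P).checkDX U.X (sphRows P.cell U.R.rho0 U.R.rho1))

/-- ★★★ **SOUNDNESS OF A MIRROR UNIT**: a mirror-checked unit proves the (T¹ᶜ) inequality for EVERY FNF chamber tuple of its slab × box —
the binders and the conclusion of 113F `SphUnit.sound` exactly: 113E `sphere_cells_dispatch` over the doubled cell list places the tuple's
direction in a part's cell (closed by 113F `sound_dietSph`) or in a part's mirror cell (closed by `sound_dietSph_swap12`). -/
theorem SphUnit.soundM (U : SphUnit) (h : U.checkM = true) :
    ∀ ρ : ℝ, (U.R.rho0 : ℝ) ≤ ρ → ρ ≤ U.R.rho1 → ∀ dt : (Fin 3 → ℤ) → ℝ,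
      (∀ q, castW U.R.lo q ≤ dt (holeVertex 0 q) ∧ dt (holeVertex 0 q) ≤ castW U.R.hi q) → ((U.R.loC : ℝ) ≤ dt 0 ∧ dt 0 ≤ U.R.hiC) →
      IsChartRealisable ρ dt → (∀ p ∈ stencil 0, 0 < dt p) → poleSum dt 0 ≤ poleSum dt 1 → poleSum dt 0 ≤ poleSum dt 2 →
      (∀ a : Fin 3, dt (holeVertex 0 (a, true)) ≤ dt (holeVertex 0 (a, false))) →
      feetHoleCost 160 (3 / 100) ρ dt 0 ≤ domCapK U.u 160 (3 / 100) ρ (chargeDepth ρ dt 0) := by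
  simp only [SphUnit.checkM, Bool.and_eq_true, decide_eq_true_eq] at h
  obtain ⟨⟨⟨⟨hT, hnn⟩, hρ0⟩, hs⟩, hall⟩ := h
  intro ρ h₀ h₁ dt hbox hC hreal hpos hch1 hch2 hchp
  obtain ⟨c, hc, hlo, hhi⟩ := sphere_cells_dispatch U.cellsM U.cover hT hnn hreal h₀ h₁ (by exact_mod_cast hρ0.le) hpos hchp
  rcases List.mem_append.1 hc with hc | hc
  · obtain ⟨P, hP, rfl⟩ := List.mem_map.1 hc
    have hchk : (U.station P).checkDX U.X (sphRows P.cell U.R.rho0 U.R.rho1) = true := List.all_eq_true.mp hall P hP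
    exact (U.station P).sound_dietSph U.X P.cell hchk ρ h₀ h₁ dt hbox hC hreal hpos hch1 hch2 hchp hlo hhi
  · obtain ⟨c', hc', rfl⟩ := List.mem_map.1 hc
    obtain ⟨P, hP, rfl⟩ := List.mem_map.1 hc'
    have hchk : (U.station P).checkDX U.X (sphRows P.cell U.R.rho0 U.R.rho1) = true := List.all_eq_true.mp hall P hP
    exact (U.station P).sound_dietSph_swap12 U.X P.cell hchk hs hρ0 ρ h₀ h₁ dt hbox hC hreal hpos hch1 hch2 hchp hlo hhi

/-- ★ BATCH FORM over a list of mirror-checked units. -/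
theorem SphUnit.soundM_of_all {Us : List SphUnit} (h : Us.all SphUnit.checkM = true) {U : SphUnit} (hU : U ∈ Us) :
    ∀ ρ : ℝ, (U.R.rho0 : ℝ) ≤ ρ → ρ ≤ U.R.rho1 → ∀ dt : (Fin 3 → ℤ) → ℝ,
      (∀ q, castW U.R.lo q ≤ dt (holeVertex 0 q) ∧ dt (holeVertex 0 q) ≤ castW U.R.hi q) → ((U.R.loC : ℝ) ≤ dt 0 ∧ dt 0 ≤ U.R.hiC) →
      IsChartRealisable ρ dt → (∀ p ∈ stencil 0, 0 < dt p) → poleSum dt 0 ≤ poleSum dt 1 → poleSum dt 0 ≤ poleSum dt 2 →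
      (∀ a : Fin 3, dt (holeVertex 0 (a, true)) ≤ dt (holeVertex 0 (a, false))) →
      feetHoleCost 160 (3 / 100) ρ dt 0 ≤ domCapK U.u 160 (3 / 100) ρ (chargeDepth ρ dt 0) :=
  U.soundM (List.all_eq_true.mp h U hU)

/-- ★ SANITY (the door box of record): the T4A door H-description's vertex box `lo = sextQ 117.713 117.713 117.369 117.713 117.369 117.713`,
`hi = sextQ 118.113 118.113 118.151 118.836 118.151 118.836` is `1 ↔ 2`-symmetric. [finite check] -/
example : (⟨679 / 1000, 691 / 1000, sextQ (117713 / 1000) (117713 / 1000) (117369 / 1000) (117713 / 1000) (117369 / 1000) (117713 / 1000),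
    sextQ (118113 / 1000) (118113 / 1000) (118151 / 1000) (118836 / 1000) (118151 / 1000) (118836 / 1000), 0, 0, [], [], []⟩ :
    StationRowsCert).symm12 = true := by
  decide +kernel

end Unit

end Summit.AtomisticToContinuum.Crystallization.Theorems.ChargedEnergyGapChartDial
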